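import Literature.NumberTheory.EllipticCurves.Kato2004.MemberHullZetaKummerCoreInputs
import Summits.BirchSwinnertonDyer.BirchSwinnertonDyer.Theorems.KatoDescentPotSupersingularZetaLineKummerToOrth
import Summits.BirchSwinnertonDyer.BirchSwinnertonDyer.Theorems.KatoDescentPotSupersingularMemberHullZetaInputsOfCore
import HarnessLib

/-!
# The PRINT-EXACT (Kummer-form) core package of crux M yields the pairing-form core package and the zeta package, in the kernel:
# `exists_memberHullZetaKummerCoreInputs → exists_memberHullZetaCoreInputs` (and `→ exists_memberHullZetaInputs` modulo PT + GZK)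
# (route `KatoDescentPotSupersingular` / `…Tame…`, crux M = stmt-BirchSwinnertonDyer-19196; route-free helper, part 65)

Seat `bsd-potss-rkm` g22 (prover; cell `bsd-potss`), item stmt-BirchSwinnertonDyer-19196 (`--supports … --as helper`; closes
nothing).  HONEST FRAMING: BSD is not proved by any of this; nothing is booked; no named fact is minted or discharged; theorems only
(no definition).  CONDITIONAL statements keep their named-fact hypotheses displayed.

WHAT.  `Kato2004.MemberHullZetaKummerCoreInputs` (`Kato2004/MemberHullZetaKummerCoreInputs.lean`, seat rkm g22) is the sibling of the
held core package `Kato2004.MemberHullZetaCoreInputs` (p630270) whose clause (b′) — Kato's local index `ν` of the zeta line at `p`,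
Prop. 14.16 (2) / Lemma 14.18 with Kim §3.2.3 — is the printed EQUALITY in the Kummer currency `ZetaLineIndexAt` rather than the
one-directional pairing form `ZetaLineOrthIndexAt`.  With the bridge `zetaLineOrthIndexAt_of_zetaLineIndexAt` (part 64, local Tate
duality for the descended Weil pairing, part 63) the Kummer-form package GIVES the pairing-form package:

* `MemberHullZetaKummerCoreInputs.zetaLineOrthIndex` — the pairing-form clause of a Kummer-form package (same `q`, same `e`);
* `MemberHullZetaKummerCoreInputs.nonempty_coreInputs` — `Nonempty (MemberHullZetaCoreInputs W p κ γ I 𝐲)`;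
* **`exists_memberHullZetaCoreInputs_of_kummerCoreInputs : exists_memberHullZetaKummerCoreInputs → exists_memberHullZetaCoreInputs`**
  (the outer texts are verbatim the same);
* `exists_memberHullZetaInputs_of_kummerCoreInputs : GZK → poitouTate_selmerStructure_duality ℚ → exists_memberHullZetaKummerCoreInputs →
  exists_memberHullZetaInputs` (through seat rkm g21's `MemberHullZetaInputsOfCore.exists_memberHullZetaInputs_of_coreInputs`).

So the planner's gen-4 held child of crux M can be keyed to the PRINT-EXACT fact `exists_memberHullZetaKummerCoreInputs`; the typed
K9 / K8-t′ closers over it are the sibling files `…ReducibleKatoMemberOfKummerCoreInputs.lean`.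

References: K. Kato, Astérisque 295 (2004), Thm. 14.5 (2) (p. 236), Prop. 14.16 (2) (pp. 244–245), Lemma 14.18 (pp. 247–248)
[Kato2004Asterisque]; C.-H. Kim, AJM 148 §3.2.3 [Kim2022StructureSelmer]; J. S. Milne, *ADT* I Cor. 2.3, Cor. 3.4, Thm. 4.10
[MilneADT2006].
-/

-- the summit and its single problem are both named `BirchSwinnertonDyer` (registry layout D-0017)
set_option linter.dupNamespace false
set_option autoImplicit false

noncomputable section

/-! ## (part 65) The Kummer-form core package yields the core package, in the kernel -/

namespace Summit.BirchSwinnertonDyer.BirchSwinnertonDyer.Theorems.MemberHullZetaCoreInputsOfKummer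

open scoped Classical NumberField
open Field
open Literature.NumberTheory.EllipticCurves Literature.NumberTheory.GaloisRepresentations
  Literature.NumberTheory.GaloisCohomology
open Literature.NumberTheory.EllipticCurves.Kato2004 Literature.NumberTheory.EllipticCurves.Kato2004.EulerSystemValues
open Summit.BirchSwinnertonDyer.BirchSwinnertonDyer.Theorems.KummerDescendedDuality

section Package

variable {W : WeierstrassCurve ℚ} [W.IsElliptic] {p : ℕ} [Fact p.Prime]
  [ContinuousSMul ℤ_[p] (W.tateModule p)] {κ : ZpExtension ℚ p} {γ : absoluteGaloisGroup ℚ}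
  {I : IwasawaH1Data W p κ γ} {y : I.H}

/-- **The pairing-form clause (b′) of a Kummer-form core package**: from `Z.zetaLineIndex` (the printed index EQUALITY
`ZetaLineIndexAt`) the one-directional pairing form `ZetaLineOrthIndexAt` with the same `q` and `e`, by the bridge
`zetaLineOrthIndexAt_of_zetaLineIndexAt` (local Tate duality for the descended Weil pairing, parts 63–64).
[cite: Kato2004Asterisque, Prop. 14.16 (2) (p. 244) and Lemma 14.18 (pp. 247–248)] [cite: MilneADT2006, Ch. I, Cor. 2.3 and Cor. 3.4] -/
theorem _root_.Literature.NumberTheory.EllipticCurves.Kato2004.MemberHullZetaKummerCoreInputs.zetaLineOrthIndex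
    (Z : MemberHullZetaKummerCoreInputs W p κ γ I y) :
    ∃ q : ℚ, W.entireLFunction 1 / (W.realPeriodRat : ℂ) = (q : ℂ) ∧
      ∃ e : ℕ, (e : ℤ) = padicValRat p q + ((PowerSeries.constantCoeff Z.lam).valuation : ℤ) +
          (padicValNat p (Nat.card (AddCommGroup.primaryComponent
            (W.baseChange ((primePlace p).adicCompletion ℚ)).toAffine.Point p)) : ℤ) -
          (padicValNat p ((W.baseChange ((primePlace p).adicCompletion ℚ)).localTamagawaNumber
            ((primePlace p).adicCompletionIntegers ℚ)) : ℤ) ∧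
        ZetaLineOrthIndexAt W p (layerZeroToTop W p κ (I.proj 0 y)) e :=
  exists_zetaLineOrthIndexAt_of_exists_zetaLineIndexAt W p (layerZeroToTop W p κ (I.proj 0 y))
    (fun q : ℚ => W.entireLFunction 1 / (W.realPeriodRat : ℂ) = (q : ℂ))
    (fun (q : ℚ) (e : ℕ) => (e : ℤ) = padicValRat p q + ((PowerSeries.constantCoeff Z.lam).valuation : ℤ) +
          (padicValNat p (Nat.card (AddCommGroup.primaryComponent
            (W.baseChange ((primePlace p).adicCompletion ℚ)).toAffine.Point p)) : ℤ) -
          (padicValNat p ((W.baseChange ((primePlace p).adicCompletion ℚ)).localTamagawaNumber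
            ((primePlace p).adicCompletionIntegers ℚ)) : ℤ))
    Z.zetaLineIndex

/-- **A Kummer-form core package gives a core package** (`MemberHullZetaCoreInputs`, clause (b′) in the pairing form), with no
further hypothesis: `Z.toMemberHullZetaCoreInputs Z.zetaLineOrthIndex`.  Stated as inhabitation (no definition in this file).
[cite: Kato2004Asterisque, Lemma 14.18 (pp. 247–248)] -/
theorem _root_.Literature.NumberTheory.EllipticCurves.Kato2004.MemberHullZetaKummerCoreInputs.nonempty_coreInputs
    (Z : MemberHullZetaKummerCoreInputs W p κ γ I y) : Nonempty (MemberHullZetaCoreInputs W p κ γ I y) :=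
  ⟨Z.toMemberHullZetaCoreInputs Z.zetaLineOrthIndex⟩

end Package

section Facts

/-- **`exists_memberHullZetaKummerCoreInputs → exists_memberHullZetaCoreInputs`**: the PRINT-EXACT (Kummer-form) held package of
crux M implies the pairing-form core package p630270 — the outer texts are verbatim the same, and at the innermost spot
`MemberHullZetaKummerCoreInputs.nonempty_coreInputs` (the bridge) applies.  So every consumer of the core fact (the zeta fact via
`MemberHullZetaInputsOfCore.exists_memberHullZetaInputs_of_coreInputs`, the typed crux-M closers) is a consumer of the Kummer fact.
[cite: Kato2004Asterisque, Prop. 14.16 (2) (p. 244) and Lemma 14.18 (pp. 247–248)] [cite: MilneADT2006, Ch. I, Cor. 3.4] -/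
theorem exists_memberHullZetaCoreInputs_of_kummerCoreInputs (h : exists_memberHullZetaKummerCoreInputs) :
    exists_memberHullZetaCoreInputs := by
  intro W _ _ p _ hp hgood hmult hj hirr hL hsha
  obtain ⟨W', hW'e, hW'm, hiso, hrest⟩ := h W p hp hgood hmult hj hirr hL hsha
  refine ⟨W', hW'e, hW'm, hiso, ?_⟩
  intro _ _ _ N _ f hf ι
  obtain ⟨κ', Λ', c, d, a, A, z, x, hκ', hA, hc, hd, hZB, hall⟩ := hrest f hf ι
  refine ⟨κ', Λ', c, d, a, A, z, x, hκ', hA, hc, hd, hZB, ?_⟩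
  intro κ γ hκ hγ I y hy
  obtain ⟨Z⟩ := hall κ γ hκ hγ I y hy
  exact Z.nonempty_coreInputs

/-- **`exists_memberHullZetaKummerCoreInputs → (GZK) → (PT) → exists_memberHullZetaInputs`**: the Kummer-form fact also yields the
held zeta package of child 20297 (through the core fact and seat rkm g21's `exists_memberHullZetaInputs_of_coreInputs`: Thm. 14.5 (2)
and Prop. 14.16 (2) re-derived from (b′), (c2′) and Poitou–Tate). [cite: Kato2004Asterisque, Thm. 14.5 (2) (p. 236) and Prop. 14.16 (2) (pp. 244–245)]
[cite: MilneADT2006, Ch. I, Thm. 4.10 (b)] -/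
theorem exists_memberHullZetaInputs_of_kummerCoreInputs (hGZK : rank_eq_analyticRank_of_analyticRank_le_one)
    (hPT : poitouTate_selmerStructure_duality ℚ) (h : exists_memberHullZetaKummerCoreInputs) : exists_memberHullZetaInputs :=
  MemberHullZetaInputsOfCore.exists_memberHullZetaInputs_of_coreInputs hGZK hPT
    (exists_memberHullZetaCoreInputs_of_kummerCoreInputs h)

end Facts

end Summit.BirchSwinnertonDyer.BirchSwinnertonDyer.Theorems.MemberHullZetaCoreInputsOfKummer

end
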